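import Mathlib
import HarnessLib
import Literature.Analysis.FluidPDE.VectorCalculus
import Literature.Analysis.FluidPDE.VorticityCalculus
import Literature.Analysis.FluidPDE.TaoLocalVelocityGradient
import Summits.NavierStokesRegularity.NavierStokesRegularity.Theorems.ThreadingFluxHorizonTowerPoloidalFieldCalculus
import Summits.NavierStokesRegularity.NavierStokesRegularity.Theorems.UnthreadedDoorAntidynamoRadialGradientUnthreaded

/-!
# Route `UnthreadedDoor` / `ThreadingFlux`, crux `PoloidalLiouville` (stmt-NavierStokesRegularity-1222), antidynamo v2 skeleton
# (sha16 `4ebf5683127b`), rung `stub_singleDegreeRung` (BC5): VORTICITY ON A REGULAR CHUNK (census step S2(b), second brick)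

Support file (seat leafhand-ns-unthreadeddoor-1 g0, cell decomp-ns), `--supports stmt-NavierStokesRegularity-1222 --as helper`; theorems only.
Continues `UnthreadedDoorAntidynamoSpherePathCoefficient.lean` (p795123: where the rung's potential `φ` is differentiable, the arbitrary
radial coefficient `g` agrees with a smooth `ĝ` on the radii swept).  Here: once `g = ĝ` on an open set of radii `J` with `ĝ ∈ C¹(J)`,
the representation `∇φ = v − (g ‖z‖ · Q z) • z` on the open set `U` upgrades to `φ ∈ C²` on `U ∩ {‖z‖ ∈ J}`, and the vorticity there is
the single-degree toroidal field
  `curl v (y) = ĝ(‖y‖) • (∇Q(y) × y)`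
(`curl ∇φ = 0`, `curl (G • id) = ∇G × id`, and the radial part `Q ∇(ĝ∘‖·‖)` of `∇G` is killed by `× y`).

* `hasFDerivAt_norm_smul_innerSL` — `D‖·‖(z) = σ(z) ⟪z, ·⟫` for `z ≠ 0` (radial derivative of the norm).
* `cross_gradient_radialMul` — `∇(ĝ(‖·‖) Q)(z) × z = ĝ(‖z‖) • (∇Q(z) × z)` (`ĝ` differentiable at `‖z‖`, `Q` at `z ≠ 0`).
* ★ `curl_eq_smul_cross_gradient_of_coeff` — the displayed vorticity formula on `U ∩ {‖z‖ ∈ J} ∖ {0}`.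

HONEST LABEL: a regularity/kinematics brick for the plan-only rung; nothing here proves the rung, the wall, `PoloidalLiouville` (1222)
or bears on NS regularity.  [folklore]
-/

noncomputable section

-- the summit and its single sub-problem share the name (CONVENTIONS §1)
set_option linter.dupNamespace false

open scoped Topology InnerProductSpace RealInnerProductSpace ContDiff
open Filter Set Function Metric
open Literature.Analysis.FluidPDE

namespace Summit.NavierStokesRegularity.NavierStokesRegularity.Theorems.PoloidalLiouville.Antidynamo

/-- The derivative of the norm at `z ≠ 0` is the multiple `2 √′(‖z‖²)` of `⟪z, ·⟫` (so `∇‖·‖` is radial). [folklore] -/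
theorem hasFDerivAt_norm_smul_innerSL {z : EuclideanSpace ℝ (Fin 3)} (hz : z ≠ 0) :
    HasFDerivAt (fun y : EuclideanSpace ℝ (Fin 3) => ‖y‖)
      ((deriv Real.sqrt (‖z‖ ^ 2) * 2) • innerSL ℝ z) z := by
  have hq : HasFDerivAt (fun y : EuclideanSpace ℝ (Fin 3) => ‖y‖ ^ 2) (2 • innerSL ℝ z) z :=
    (hasStrictFDerivAt_norm_sq z).hasFDerivAt
  have ht0 : ‖z‖ ^ 2 ≠ 0 := pow_ne_zero _ (norm_ne_zero_iff.2 hz)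
  have hg : DifferentiableAt ℝ Real.sqrt (‖z‖ ^ 2) := (Real.hasDerivAt_sqrt ht0).differentiableAt
  have hcomp := hg.hasDerivAt.comp_hasFDerivAt z hq
  have heq : (Real.sqrt ∘ fun y : EuclideanSpace ℝ (Fin 3) => ‖y‖ ^ 2) = fun y => ‖y‖ := by
    funext y
    simp only [comp_apply, Real.sqrt_sq (norm_nonneg y)]
  rw [heq] at hcomp
  refine hcomp.congr_fderiv ?_
  ext w
  simp
  ring

/-- `∇(ĝ(‖·‖) · Q)(z) × z = ĝ(‖z‖) • (∇Q(z) × z)` for `z ≠ 0`: the radial part `Q(z) ∇(ĝ∘‖·‖)(z) ∥ z` of the gradient drops out of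
the cross product. [folklore] -/
theorem cross_gradient_radialMul {ĝ : ℝ → ℝ} {Q : EuclideanSpace ℝ (Fin 3) → ℝ} {z : EuclideanSpace ℝ (Fin 3)} (hz : z ≠ 0)
    (hĝ : DifferentiableAt ℝ ĝ ‖z‖) (hQ : DifferentiableAt ℝ Q z) :
    cross (gradient (fun y : EuclideanSpace ℝ (Fin 3) => ĝ ‖y‖ * Q y) z) z = ĝ ‖z‖ • cross (gradient Q z) z := by
  set c₀ : ℝ := deriv Real.sqrt (‖z‖ ^ 2) * 2 with hc₀
  have hn : HasFDerivAt (fun y : EuclideanSpace ℝ (Fin 3) => ĝ ‖y‖) (deriv ĝ ‖z‖ • (c₀ • innerSL ℝ z)) z :=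
    hĝ.hasDerivAt.comp_hasFDerivAt z (hasFDerivAt_norm_smul_innerSL hz)
  have hprod : HasFDerivAt (fun y : EuclideanSpace ℝ (Fin 3) => ĝ ‖y‖ * Q y)
      (ĝ ‖z‖ • fderiv ℝ Q z + Q z • (deriv ĝ ‖z‖ • (c₀ • innerSL ℝ z))) z := hn.mul hQ.hasFDerivAt
  have hgrad : gradient (fun y : EuclideanSpace ℝ (Fin 3) => ĝ ‖y‖ * Q y) z =
      ĝ ‖z‖ • gradient Q z + (Q z * (deriv ĝ ‖z‖ * c₀)) • z := by
    rw [gradient, hprod.fderiv, gradient]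
    apply (InnerProductSpace.toDual ℝ (EuclideanSpace ℝ (Fin 3))).injective
    rw [LinearIsometryEquiv.apply_symm_apply]
    ext w
    simp only [_root_.add_apply, _root_.smul_apply, smul_eq_mul, innerSL_apply_apply,
      InnerProductSpace.toDual_apply_apply, inner_add_left, real_inner_smul_left, InnerProductSpace.toDual_symm_apply]
    ring
  have hzz : cross z z = 0 := by simpa using cross_smul_self_left 1 z
  rw [hgrad, ← crossCLM_apply, map_add, map_smul, map_smul]
  simp only [_root_.add_apply, _root_.smul_apply, crossCLM_apply, hzz, smul_zero, add_zero]

/-- ★ VORTICITY ON A REGULAR CHUNK.  Let `v ∈ C¹`, `Q ∈ C¹`, `U` open, `φ` differentiable on `U` with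
`∇φ = v − (g ‖z‖ · Q z) • z` there (the rung's representation; `g` arbitrary), and suppose that on an open set of radii `J` the
coefficient agrees with a `C¹` function, `g = ĝ` on `J`.  Then at every `y ∈ U` with `‖y‖ ∈ J`, `y ≠ 0`:
`curl v (y) = ĝ(‖y‖) • (∇Q(y) × y)`.  Proof: on the open set `O = U ∩ {‖z‖ ∈ J} ∖ {0}` the field `F = v − (ĝ(‖z‖) Q z) • z` is `C¹` and
equals `∇φ`, so `φ ∈ C²(O)` and `curl ∇φ = 0` there; `curl (v − F) = curl (G • id) = ∇G × id`. [folklore] -/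
theorem curl_eq_smul_cross_gradient_of_coeff {v : EuclideanSpace ℝ (Fin 3) → EuclideanSpace ℝ (Fin 3)} (hv : ContDiff ℝ 1 v)
    {φ : EuclideanSpace ℝ (Fin 3) → ℝ} {g : ℝ → ℝ} {Q : EuclideanSpace ℝ (Fin 3) → ℝ} (hQ : ContDiff ℝ 1 Q)
    {U : Set (EuclideanSpace ℝ (Fin 3))} (hU : IsOpen U)
    (hφ : ∀ z ∈ U, DifferentiableAt ℝ φ z) (hrep : ∀ z ∈ U, gradient φ z = v z - (g ‖z‖ * Q z) • z)
    {J : Set ℝ} (hJ : IsOpen J) {ĝ : ℝ → ℝ} (hĝ : ContDiffOn ℝ 1 ĝ J) (hgĝ : ∀ r ∈ J, g r = ĝ r)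
    {y : EuclideanSpace ℝ (Fin 3)} (hyU : y ∈ U) (hyJ : ‖y‖ ∈ J) (hy0 : y ≠ 0) :
    curl v y = ĝ ‖y‖ • cross (gradient Q y) y := by
  -- the open set `O`
  set O : Set (EuclideanSpace ℝ (Fin 3)) := (U ∩ (fun z => ‖z‖) ⁻¹' J) ∩ {z | z ≠ 0} with hO
  have hOo : IsOpen O := (hU.inter (continuous_norm.isOpen_preimage _ hJ)).inter isOpen_ne
  have hyO : y ∈ O := ⟨⟨hyU, hyJ⟩, hy0⟩
  -- the smooth coefficient field `G z = ĝ ‖z‖ * Q z` and `F = v − G • id`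
  set G : EuclideanSpace ℝ (Fin 3) → ℝ := fun z => ĝ ‖z‖ * Q z with hG
  have hGd : ∀ z ∈ O, ContDiffAt ℝ 1 G z := by
    intro z hz
    have h1 : ContDiffAt ℝ 1 (fun w : EuclideanSpace ℝ (Fin 3) => ĝ ‖w‖) z :=
      (hĝ.contDiffAt (hJ.mem_nhds hz.1.2)).comp z (contDiffAt_norm ℝ hz.2)
    exact h1.mul hQ.contDiffAt
  set F : EuclideanSpace ℝ (Fin 3) → EuclideanSpace ℝ (Fin 3) := fun z => v z - G z • z with hF
  have hFd : ∀ z ∈ O, ContDiffAt ℝ 1 F z := fun z hz =>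
    hv.contDiffAt.sub ((hGd z hz).smul contDiffAt_id)
  have hrepO : ∀ z ∈ O, gradient φ z = F z := by
    intro z hz
    rw [hrep z hz.1.1, hgĝ _ hz.1.2]
  -- `φ ∈ C²(O)`
  have hφ2 : ContDiffOn ℝ 2 φ O := by
    have hdiff : DifferentiableOn ℝ φ O := fun z hz => (hφ z hz.1.1).differentiableWithinAt
    have hfd : ∀ z ∈ O, fderiv ℝ φ z = (InnerProductSpace.toDual ℝ (EuclideanSpace ℝ (Fin 3))) (F z) := by
      intro z hz
      rw [← hrepO z hz, gradient, LinearIsometryEquiv.apply_symm_apply]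
    have h1 : ContDiffOn ℝ 1 (fderiv ℝ φ) O := by
      have : ContDiffOn ℝ 1 (fun z => (InnerProductSpace.toDual ℝ (EuclideanSpace ℝ (Fin 3))) (F z)) O :=
        fun z hz => ((InnerProductSpace.toDual ℝ (EuclideanSpace ℝ (Fin 3))).contDiff.contDiffAt.comp z
          (hFd z hz)).contDiffWithinAt
      exact this.congr hfd
    rw [show (2 : WithTop ℕ∞) = 1 + 1 by norm_num, contDiffOn_succ_iff_fderiv_of_isOpen hOo]
    exact ⟨hdiff, fun h1ω => absurd h1ω (by simp), h1⟩
  have hcurlφ : curl (gradient φ) y = 0 := curl_gradient_eq_zero_of_contDiffOn hOo hφ2 hyO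
  -- `curl F y = 0` and `curl v y = curl (G • id) y`
  have hFev : F =ᶠ[𝓝 y] gradient φ := by
    filter_upwards [hOo.mem_nhds hyO] with z hz using (hrepO z hz).symm
  have hcurlF : curl F y = 0 := by rw [curl_congr_of_eventuallyEq hFev, hcurlφ]
  have hvd : DifferentiableAt ℝ v y := hv.differentiable one_ne_zero y
  have hGdy : DifferentiableAt ℝ G y := (hGd y hyO).differentiableAt one_ne_zero
  have hGid : DifferentiableAt ℝ (fun z => G z • z) y := hGdy.smul differentiableAt_id
  have hsub : curl F y = curl v y - curl (fun z => G z • z) y := curl_sub hvd hGid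
  rw [hcurlF] at hsub
  have hv' : curl v y = curl (fun z => G z • z) y := sub_eq_zero.1 hsub.symm
  rw [hv', PoloidalField.curl_smul_self hGdy]
  exact cross_gradient_radialMul hy0 ((hĝ.differentiableOn one_ne_zero).differentiableAt (hJ.mem_nhds hyJ))
    (hQ.differentiable one_ne_zero y)

end Summit.NavierStokesRegularity.NavierStokesRegularity.Theorems.PoloidalLiouville.Antidynamo

end
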